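import Summits.HodgeConjecture.HodgeConjecture.Theorems.Ring2ClassTargetsRowsSixSevenWeilPullbacks
import Summits.HodgeConjecture.HodgeConjecture.Theorems.Ring2TransportWeilClasses
import HarnessLib

/-!
# Ring 2 — class targets: the two summands of André's codimension-2 Weil pull-backs, priced separately

research route conditional on HC_CM; not a corollary; Q11.4-sentence-2 already refuted in dim ≥ 3.

Cell `pub-hodge-ring2`, seat typer1 = cell LEAD (gen 7). `HC_CM` := the binder
`Theses.RankFourFaces.CMAbelianHodge` (stmt-HodgeConjecture-3052) BY NAME; nothing here proves it or
`CMToAbelian` (stmt-16267); nothing here is a new case of the Hodge conjecture.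

PURPOSE. The third summand of X2′ (`CodimTwoFromWeilPullbacks`, p193119), `codimTwoWeilPullbacks A`, is by
definition a union `S₁ ∪ S₂`: `S₁` = pull-backs `g^*ω` of rational `(2,2)` Weil classes of Weil-type
FOURFOLDS (imaginary quadratic `k`); `S₂` = pull-backs of rational `(2,2)` Weil classes `W_K` of abelian
varieties of CM-FIELD Weil type with `e · 4 = 2 · dim B` (`K` a CM field of degree `e > 2`, so `dim B = 2e ≥ 8`).
The junction file `Ring2ClassTargetsRowsSixSevenJunction` (p193370, §J1; not imported — this file sits BESIDE it
on the two leaves it needs) priced `S₁ ∪ S₂` by R∞ + Moonen–Zarhin (Thms. 0.1, 0.2) + R3. This file NAMES the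
two summands and prices each by EXACTLY the input it needs, by name:
 * §S2 `S₁` is algebraic on every abelian variety from the FLOOR FACT alone
   (`Markman2025_weilClasses_algebraic_abelianFourfold` = R∞ at `n = 2`; no Moonen–Zarhin, no R3), or from `HCUpToDim 4`;
 * §S3 `S₂` is algebraic on every abelian variety from R3 alone (`WeilTypeLadder.WeilClassesCMField`) — indeed
   from its codimension-2 slice OFF any class `𝒞` (`CodimTwoWeilClassesCMFieldOff 𝒞`, "the price") plus HC on `𝒞`;
   with `𝒞 = CM type` and `HC_CM`: from `HC_CM` + the price off the CM locus, or from `HC_CM` + the two CM-FIELD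
   transport leaves only (`CMPointedWeilFamiliesCMField`, `WeilVariationalHodgeCMField`) — `HC_CM` load-bearing ONCE;
 * §S4 the junction bound sharpened: `S₁ ∪ S₂` algebraic from the floor fact ∧ R3, and the on-path audit.

PLACEMENT RECORD (RING2-MAP §LEAD gen 7, L7.3; not used by any theorem). By the cell's computation K3-WP
(evidence `K3-WEIL-PULLBACK.md` on stmt-HodgeConjecture-18721: two independent implementations + a referee
reproduction + a hand proof; NOT in print, NOT a Lean theorem; no statement below depends on it) the K3-partner
exceptional classes of a sixfold `Y × Z` (`Y` simple of type IV with `End⁰ = E` quartic CM, signature `(2,0),(1,1)`;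
`Z` the CM surface with `T(Z) ≅ det_E H¹(Y)`) lie in `span S₂` with source the `E`-Weil eightfold `Y × Z × Z`
(`n_σ = 2`, `m = 2`) along `id_Y × Δ_Z`. READ THROUGH §S3, their algebraicity is a CONSEQUENCE of the single
R3-instance at (`E` quartic, `2m = 4`, dim 8) — strictly above the floor `S₁` whenever `E` contains no imaginary
quadratic subfield (e.g. `E = ℚ(ζ₅)`, whose quadratic subfield `ℚ(√5)` is real), and NOT itself a rung. The atlas
seat's `HC_CM`-free claim for `E = ℚ(ζ₅)` (`Ring2.Atlas.CyclotomicFiveK3PartnerAlgebraicInstance`, p193375, a `Prop`,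
nothing asserted; refereeing pending) would pay one `(E, δ)`-row of that consequence without climbing R3.

Honest column: the floor fact is Markman's fourfold theorem, UNREFEREED beyond the discriminants in print; R3 is OPEN
(in print only on Schoen's cyclic Prym loci); the transport leaves are OPEN typed statements of
`Ring2TransportWeilClasses`; `S₁`, `S₂` being algebraic ARE consequences of HC (§S4), unlike X2′ itself.
References: [cite: Andre1992HodgeCM, Théorème] [cite: CharlesSchnell2014Notes, Thm. 11.5.21]
[cite: MoonenZarhin1998WeilClasses, §1] [cite: MoonenZarhin1999LowDim, Thm. 0.2 (e),(f)]
[cite: Markman2025SecantRealMultiplication, Thm. 1.5.1, Cor. 1.6.1 (preprint, unrefereed)] [cite: vanGeemen1994HodgeAV, Thm. 6.12]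
[cite: Deligne1982HodgeCycles, §4–5] [cite: Milne1999, §7 (H)]
-/

set_option linter.dupNamespace false

noncomputable section

open CategoryTheory Literature.AlgebraicGeometry Literature.AlgebraicGeometry.Motives
open Literature.AlgebraicGeometry.HodgeTheory Literature.AlgebraicGeometry.Milne1999
open Literature.AlgebraicTopology.SingularHomology Literature.Barriers.HodgeConjecture

namespace Summit.HodgeConjecture.HodgeConjecture.Ring2.ClassTargets

open WeilTypeLadder Ring2Transport

/-! ## §S1 The two summands, by name -/

/-- `S₁`: pull-backs to `A`, along any morphism `g : A.X ⟶ B.X`, of rational `(2,2)` Weil classes of an abelian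
FOURFOLD `B` of Weil type (`ψ ≫ ψ = -d`, `ω ∈ weilClassesOf B ψ 2 d`, `k = ℚ(√-d)`) — VERBATIM the left operand of the
union `codimTwoWeilPullbacks A`. [cite: MoonenZarhin1999LowDim, Thm. 0.2 (e),(f)] [cite: Andre1992HodgeCM, Théorème] -/
def fourfoldWeilPullbacks (A : AbelianVariety ℂ) : Set (complexBetti A.X (2 * 2)) :=
  {c' : complexBetti A.X (2 * 2) |
      ∃ (B : AbelianVariety ℂ) (g : A.X ⟶ B.X) (d : ℕ) (ψ : B ⟶ B) (w : complexBetti B.X (2 * 2)),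
        B.dim = 2 * 2 ∧ 0 < d ∧ ψ ≫ ψ = -(d • 𝟙 B) ∧ IsRationalClass w ∧
          IsOfHodgeType (2 * 2) B.X (2 * 2) 2 2 w ∧ w ∈ weilClassesOf B ψ 2 d ∧
          c' = complexBetti.map g (2 * 2) w}

/-- `S₂`: pull-backs to `A`, along any morphism `g : A.X ⟶ B.X`, of rational `(2,2)` Weil classes
`ω ∈ weilClassesField B ψ P 4` of an abelian variety `B` of CM-FIELD Weil type — `K = ℚ(ψ) ≅ ℚ[T]⁄(P)` a CM field of
degree `e > 2`, `e · 4 = 2 · dim B` — VERBATIM the right operand of the union `codimTwoWeilPullbacks A`. By the cell's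
computation K3-WP (module docstring; not used here) this summand contains the K3-partner exceptional classes.
[cite: MoonenZarhin1998WeilClasses, §1] [cite: Andre1992HodgeCM, Théorème] -/
def cmFieldWeilPullbacks (A : AbelianVariety ℂ) : Set (complexBetti A.X (2 * 2)) :=
  {c' : complexBetti A.X (2 * 2) |
      ∃ (B : AbelianVariety ℂ) (g : A.X ⟶ B.X) (ψ : B ⟶ B) (P : Polynomial ℤ) (e : ℕ)
        (w : complexBetti B.X (2 * 2)),
        P.Monic ∧ P.natDegree = e ∧ 2 < e ∧ Irreducible (P.map (Int.castRingHom ℚ)) ∧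
          Polynomial.eval₂ (Int.castRingHom (CategoryTheory.End B)) (ψ : CategoryTheory.End B) P = 0 ∧
          e * (2 * 2) = 2 * B.dim ∧
          (∀ ρ : ℂ, Polynomial.eval₂ (Int.castRingHom ℂ) ρ P = 0 → starRingEnd ℂ ρ ≠ ρ) ∧
          (∃ Q : Polynomial ℚ, ∀ ρ : ℂ, Polynomial.eval₂ (Int.castRingHom ℂ) ρ P = 0 →
              Polynomial.eval₂ (algebraMap ℚ ℂ) ρ Q = starRingEnd ℂ ρ) ∧
          w ∈ weilClassesField B ψ P (2 * 2) ∧ IsRationalClass w ∧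
          IsOfHodgeType B.dim B.X (2 * 2) 2 2 w ∧ c' = complexBetti.map g (2 * 2) w}

/-- The third summand of X2′ IS `S₁ ∪ S₂`, definitionally. [cite: Andre1992HodgeCM, Théorème] -/
theorem codimTwoWeilPullbacks_eq_union (A : AbelianVariety ℂ) :
    codimTwoWeilPullbacks A = fourfoldWeilPullbacks A ∪ cmFieldWeilPullbacks A := rfl

/-- `S₁ ⊆ S₁ ∪ S₂`. [cite: Andre1992HodgeCM, Théorème] -/
theorem fourfoldWeilPullbacks_subset (A : AbelianVariety ℂ) : fourfoldWeilPullbacks A ⊆ codimTwoWeilPullbacks A :=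
  Set.subset_union_left

/-- `S₂ ⊆ S₁ ∪ S₂`. [cite: Andre1992HodgeCM, Théorème] -/
theorem cmFieldWeilPullbacks_subset (A : AbelianVariety ℂ) : cmFieldWeilPullbacks A ⊆ codimTwoWeilPullbacks A :=
  Set.subset_union_right

/-! ## §S2 The fourfold summand costs exactly the floor -/

/-- **`S₁` is algebraic on EVERY abelian variety from the floor fact alone** (Weil classes of Weil-type fourfolds
algebraic — Markman's theorem as a named hypothesis; = R∞ at `n = 2`): pull-backs of algebraic classes along
morphisms of abelian varieties are algebraic. No Moonen–Zarhin fact, no R3, no `HC_CM`.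
[cite: Markman2025SecantRealMultiplication, Thm. 1.5.1, Cor. 1.6.1 (preprint, unrefereed)] -/
theorem span_fourfoldWeilPullbacks_le_algebraicClasses_of_floor
    (hW : Markman2025_weilClasses_algebraic_abelianFourfold) (A : AbelianVariety ℂ) :
    Submodule.span ℂ (fourfoldWeilPullbacks A) ≤ algebraicClasses A.X 2 := by
  have hX : IsSmoothProjective A.dim A.X := AbelianVariety.isSmoothProjective_holds
  refine Submodule.span_le.mpr ?_
  rintro _ ⟨B, g, d, ψ, w, hB, hd, hψ, hw, hwt, hweil, rfl⟩
  have hXB : IsSmoothProjective (2 * 2) B.X := by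
    rw [← hB]; exact AbelianVariety.isSmoothProjective_holds
  exact map_mem_algebraicClasses_of_abelianVariety hX B g (hW d hd B ψ hB hXB hψ w hw hwt hweil)

/-- The same from the ladder rung R∞ (read at `n = 2` through `floorFourfolds_of_weilClassesImaginaryQuadratic`).
[cite: Deligne1982HodgeCycles, §4–5] -/
theorem span_fourfoldWeilPullbacks_le_algebraicClasses_of_weilClassesImaginaryQuadratic
    (hR : WeilClassesImaginaryQuadratic) (A : AbelianVariety ℂ) :
    Submodule.span ℂ (fourfoldWeilPullbacks A) ≤ algebraicClasses A.X 2 :=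
  span_fourfoldWeilPullbacks_le_algebraicClasses_of_floor (floorFourfolds_of_weilClassesImaginaryQuadratic hR) A

/-- The same from HC for abelian varieties of dimension `≤ 4` (the matrix row, `HCUpToDim 4`; equivalent to the floor
fact modulo Moonen–Zarhin Thm. 0.1, `hcUpToDim_four_iff_weilClassesFourfolds`). [cite: MoonenZarhin1999LowDim, Thm. 0.1] -/
theorem span_fourfoldWeilPullbacks_le_algebraicClasses_of_hcUpToDim_four (h₄ : HCUpToDim 4)
    (A : AbelianVariety ℂ) : Submodule.span ℂ (fourfoldWeilPullbacks A) ≤ algebraicClasses A.X 2 := by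
  have hX : IsSmoothProjective A.dim A.X := AbelianVariety.isSmoothProjective_holds
  refine Submodule.span_le.mpr ?_
  rintro _ ⟨B, g, d, ψ, w, hB, _, _, hw, hwt, _, rfl⟩
  refine map_mem_algebraicClasses_of_abelianVariety hX B g ((h₄ B (by omega)).2 2 w hw ?_)
  rw [hB]; exact hwt

/-! ## §S3 The CM-field summand costs exactly R3 at `2m = 4` (off a class, plus HC on the class) -/

/-- **`S₂` is algebraic on EVERY abelian variety from HC on a class `𝒞` and the codimension-2 CM-field price OFF
`𝒞`**: a source `B ∈ 𝒞` is paid by `h𝒞`, a source `B ∉ 𝒞` by `h₆`. [cite: MoonenZarhin1998WeilClasses, §1]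
[cite: Andre1992HodgeCM, Théorème] -/
theorem span_cmFieldWeilPullbacks_le_algebraicClasses_of_hcOnClass_of_priceOff {𝒞 : AbelianVariety ℂ → Prop}
    (h𝒞 : HCOnClass 𝒞) (h₆ : CodimTwoWeilClassesCMFieldOff 𝒞) (A : AbelianVariety ℂ) :
    Submodule.span ℂ (cmFieldWeilPullbacks A) ≤ algebraicClasses A.X 2 := by
  have hX : IsSmoothProjective A.dim A.X := AbelianVariety.isSmoothProjective_holds
  refine Submodule.span_le.mpr ?_
  rintro _ ⟨B, g, ψ, P, e, w, hP, hPe, he, hirr, hev, hdim, hreal, hQ, hweil, hw, hwt, rfl⟩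
  refine map_mem_algebraicClasses_of_abelianVariety hX B g ?_
  by_cases hB𝒞 : 𝒞 B
  · exact (h𝒞 B hB𝒞).2 2 w hw hwt
  · exact h₆ B ψ P e hP hPe he hirr hev hdim hreal hQ hB𝒞 w hweil hw hwt

/-- **`S₂` is algebraic on EVERY abelian variety from R3 alone** (`𝒞 = ∅`). READ WITH K3-WP (module docstring):
the K3-partner exceptional classes are algebraic as a CONSEQUENCE of the R3-instance at (`E` quartic, `2m = 4`,
dim 8) — the placement "under R3, above the floor" of RING2-MAP §LEAD gen 7, L7.3.
[cite: MoonenZarhin1998WeilClasses, §1] [cite: vanGeemen1994HodgeAV, Thm. 6.12] -/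
theorem span_cmFieldWeilPullbacks_le_algebraicClasses_of_weilClassesCMField (hR3 : WeilClassesCMField)
    (A : AbelianVariety ℂ) : Submodule.span ℂ (cmFieldWeilPullbacks A) ≤ algebraicClasses A.X 2 :=
  span_cmFieldWeilPullbacks_le_algebraicClasses_of_hcOnClass_of_priceOff (𝒞 := fun _ ↦ False)
    (fun _ h ↦ h.elim) (codimTwoWeilClassesCMFieldOff_of_weilClassesCMField hR3 _) A

/-- **`S₂` under `HC_CM`**: from `HC_CM` (binder, by name) + the price off the CM locus.
[cite: Milne1999, §7 (H)] [cite: MoonenZarhin1998WeilClasses, §1] -/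
theorem span_cmFieldWeilPullbacks_le_algebraicClasses_of_hcCM_of_priceOffCM
    (hCM : Theses.RankFourFaces.CMAbelianHodge) (h₆ : CodimTwoWeilClassesCMFieldOff IsOfCMType)
    (A : AbelianVariety ℂ) : Submodule.span ℂ (cmFieldWeilPullbacks A) ≤ algebraicClasses A.X 2 :=
  span_cmFieldWeilPullbacks_le_algebraicClasses_of_hcOnClass_of_priceOff (hcOnClass_cmType_of_hcCM hCM) h₆ A

/-- **`S₂` under `HC_CM` + the CM-FIELD transport leaves only** (`CMPointedWeilFamiliesCMField`,
`WeilVariationalHodgeCMField`, through `HC_WeilClassesCMField_of_HC_CM`): the quadratic leaves and the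
Moonen–Zarhin facts of the junction's §J3 are not needed for this summand; `HC_CM` is load-bearing ONCE (as the
CM anchor of the `K`-Weil transport). [cite: Deligne1982HodgeCycles, §4–5] [cite: Milne1999, §7 (H)] -/
theorem span_cmFieldWeilPullbacks_le_algebraicClasses_of_hcCM_of_transportCMField
    (hCM : Theses.RankFourFaces.CMAbelianHodge) (hP : CMPointedWeilFamiliesCMField)
    (hV : WeilVariationalHodgeCMField) (A : AbelianVariety ℂ) :
    Submodule.span ℂ (cmFieldWeilPullbacks A) ≤ algebraicClasses A.X 2 :=
  span_cmFieldWeilPullbacks_le_algebraicClasses_of_weilClassesCMField (HC_WeilClassesCMField_of_HC_CM hCM hP hV) A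

/-! ## §S4 The junction bound, sharpened; on-path audit -/

/-- **`S₁ ∪ S₂` is algebraic on every abelian variety from the floor fact ∧ R3** — SHARPER than the junction's
`span_codimTwoWeilPullbacks_le_algebraicClasses_of_rungs` (no Moonen–Zarhin fact; R∞ only at `n = 2`).
[cite: Andre1992HodgeCM, Théorème] [cite: Markman2025SecantRealMultiplication, Cor. 1.6.1 (preprint, unrefereed)]
[cite: MoonenZarhin1998WeilClasses, §1] -/
theorem span_codimTwoWeilPullbacks_le_algebraicClasses_of_floor_of_weilClassesCMField
    (hW : Markman2025_weilClasses_algebraic_abelianFourfold) (hR3 : WeilClassesCMField) (A : AbelianVariety ℂ) :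
    Submodule.span ℂ (codimTwoWeilPullbacks A) ≤ algebraicClasses A.X 2 := by
  rw [codimTwoWeilPullbacks_eq_union]
  refine Submodule.span_le.mpr (Set.union_subset ?_ ?_)
  · exact Submodule.span_le.mp (span_fourfoldWeilPullbacks_le_algebraicClasses_of_floor hW A)
  · exact Submodule.span_le.mp (span_cmFieldWeilPullbacks_le_algebraicClasses_of_weilClassesCMField hR3 A)

/-- The same off a class: HC on `𝒞`, the floor fact, and the price off `𝒞`. [cite: Andre1992HodgeCM, Théorème]
[cite: MoonenZarhin1998WeilClasses, §1] -/
theorem span_codimTwoWeilPullbacks_le_algebraicClasses_of_floor_of_hcOnClass_of_priceOff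
    {𝒞 : AbelianVariety ℂ → Prop} (hW : Markman2025_weilClasses_algebraic_abelianFourfold) (h𝒞 : HCOnClass 𝒞)
    (h₆ : CodimTwoWeilClassesCMFieldOff 𝒞) (A : AbelianVariety ℂ) :
    Submodule.span ℂ (codimTwoWeilPullbacks A) ≤ algebraicClasses A.X 2 := by
  rw [codimTwoWeilPullbacks_eq_union]
  refine Submodule.span_le.mpr (Set.union_subset ?_ ?_)
  · exact Submodule.span_le.mp (span_fourfoldWeilPullbacks_le_algebraicClasses_of_floor hW A)
  · exact Submodule.span_le.mp (span_cmFieldWeilPullbacks_le_algebraicClasses_of_hcOnClass_of_priceOff h𝒞 h₆ A)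

/-- ON-PATH: both summands being algebraic are consequences of the summit (through the ladder's on-path lemmas for
R∞ and R3); nothing stronger than the Hodge conjecture is claimed. [cite: Deligne2000, §1] -/
theorem weilPullbacksSplit_of_hodgeConjecture (h : _root_.HodgeConjecture) (A : AbelianVariety ℂ) :
    Submodule.span ℂ (fourfoldWeilPullbacks A) ≤ algebraicClasses A.X 2 ∧
      Submodule.span ℂ (cmFieldWeilPullbacks A) ≤ algebraicClasses A.X 2 :=
  ⟨span_fourfoldWeilPullbacks_le_algebraicClasses_of_weilClassesImaginaryQuadratic
      (weilClassesImaginaryQuadratic_of_hodgeConjecture h) A,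
    span_cmFieldWeilPullbacks_le_algebraicClasses_of_weilClassesCMField (weilClassesCMField_of_hodgeConjecture h) A⟩

end Summit.HodgeConjecture.HodgeConjecture.Ring2.ClassTargets

end
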